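import Summits.QuantumAdvantage.AdviceFreeQNC0.CounterLaws
import Summits.QuantumAdvantage.AdviceFreeQNC0.TransferWalk
import Summits.QuantumAdvantage.AdviceFreeQNC0.ConstantBellsDense
import HarnessLib

/-!
# Counter strategies II — the adapted process of a counter strategy and its laws

Planner qa-qnc0-p2 g15, ROUND-15 (p2) §3.15 ADDENDUM 2 (R13 window-free).  For a strategy `y` of α's u-walk game whose
cut `t` reads the input only through `W_{<t} mod p` (firing table `fTab`), the run on input `u` is the deterministic
trajectory `X u t = (register, label, counter) ∈ CounterLaw.St p` (`CounterLaws.lean`):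
* label `labN u t = t + W_{<t} (mod 3)`, counter `ctrN u t = W_{<t} (mod p)`;
* register `regN u t ∈ V₄`: start `0`; a fire at cut `t` toggles it at the current label (`tog`);
* `X u t` = state BEFORE the fire decision at cut `t`, `Xp u t` = state AFTER it; `X u (t+1) = bitEq (u t) (Xp u t)`.
PROVED: `ev (regN u t) s` = parity of the fired cuts `j < t` with label `≠ s` (`ev_regN`); **`lose_iff`**: `u` LOSES
(`ringWinU c y u = false`) iff `(register, label)` after cut `n` lies in the member `L_{(n − c, 0)}` of the translate family;
prefix-adaptedness (`Xp_update`); and the LAW RECURSION for the counting laws `law t x = #{u : X u t = x}`,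
`lawP t x = #{u : Xp u t = x}`: `lawP t = law t ∘ fireMap t` (`lawP_eq`), `law (t+1) (g,a,b) = ½(lawP t (g,a−1,b) +
lawP t (g,a−2,b−1))` (`law_succ`), `law 0` = point mass (`law_zero`), total mass `2ⁿ`, the LOSE count as a mass
(`card_lose_eq`).  WHAT THIS IS NOT: the budget/assembly is `CounterStrategies.lean`; instrument; separation NOT moved.
-/

namespace Summit.QuantumAdvantage.AdviceFreeQNC0.CounterLaw

open Finset

variable {n : ℕ}

/-! ## §1 Prefix weights (`wtPrefix_zero`, `wtPrefix_self` are `TransferWalk`'s / `ConstBells`') -/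

/-- `W_{<t+1} = W_{<t} + u_t`. -/
theorem wtPrefix_succ_eq (u : Fin n → Bool) (t : Fin n) :
    wtPrefix u (t.val + 1) = wtPrefix u t.val + (u t).toNat := by
  unfold wtPrefix
  have hsplit : (univ.filter fun i : Fin n => i.val < t.val + 1 ∧ u i = true)
      = (univ.filter fun i : Fin n => i.val < t.val ∧ u i = true) ∪
        (univ.filter fun i : Fin n => i = t ∧ u i = true) := by
    ext i
    simp only [mem_filter, mem_univ, true_and, mem_union]
    constructor
    · rintro ⟨hi, hu⟩
      rcases Nat.lt_succ_iff_lt_or_eq.mp hi with h | h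
      · exact Or.inl ⟨h, hu⟩
      · exact Or.inr ⟨Fin.ext h, hu⟩
    · rintro (⟨hi, hu⟩ | ⟨rfl, hu⟩)
      · exact ⟨Nat.lt_succ_of_lt hi, hu⟩
      · exact ⟨Nat.lt_succ_self _, hu⟩
  rw [hsplit, card_union_of_disjoint]
  · congr 1
    cases ht : u t
    · simp only [Bool.toNat_false, card_eq_zero, filter_eq_empty_iff, mem_univ]
      intro i _ h
      rw [h.1, ht] at h
      exact Bool.false_ne_true h.2
    · rw [Bool.toNat_true, card_eq_one]
      refine ⟨t, ?_⟩
      ext i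
      simp only [mem_filter, mem_univ, true_and, mem_singleton]
      constructor
      · exact fun h => h.1
      · rintro rfl; exact ⟨rfl, ht⟩
  · rw [disjoint_filter]
    rintro i _ ⟨hi, _⟩ ⟨rfl, _⟩
    exact lt_irrefl _ hi

/-- the prefix weights `W_{<j}`, `j ≤ i`, do not read bit `i`. -/
theorem wtPrefix_update_of_le (u : Fin n → Bool) (i : Fin n) (β : Bool) {j : ℕ} (hj : j ≤ i.val) :
    wtPrefix (Function.update u i β) j = wtPrefix u j := by
  unfold wtPrefix
  congr 1
  ext k
  simp only [mem_filter, mem_univ, true_and]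
  constructor
  · rintro ⟨hk, hu⟩
    rw [Function.update_of_ne (Fin.ne_of_val_ne (Nat.ne_of_lt (lt_of_lt_of_le hk hj)))] at hu
    exact ⟨hk, hu⟩
  · rintro ⟨hk, hu⟩
    rw [Function.update_of_ne (Fin.ne_of_val_ne (Nat.ne_of_lt (lt_of_lt_of_le hk hj)))]
    exact ⟨hk, hu⟩

/-! ## §2 The adapted process of a counter strategy -/

section Process

variable (p : ℕ) (y : Fin (n + 1) → (Fin n → Bool) → Bool)

open scoped Classical in
/-- the firing table of cut `t`: what `y t` does on the inputs whose prefix count is `b (mod p)` (`false` if none). -/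
noncomputable def fTab (t : Fin (n + 1)) (b : ZMod p) : Bool :=
  if h : ∃ u : Fin n → Bool, ((wtPrefix u t.val : ℕ) : ZMod p) = b then y t (Classical.choose h) else false

/-- a counter strategy is its firing table applied to the counter. -/
theorem fTab_spec
    (hy : ∀ g : Fin (n + 1), ∀ u v : Fin n → Bool, wtPrefix u g.val % p = wtPrefix v g.val % p → y g u = y g v)
    (t : Fin (n + 1)) (u : Fin n → Bool) : fTab p y t ((wtPrefix u t.val : ℕ) : ZMod p) = y t u := by
  have h : ∃ v : Fin n → Bool, ((wtPrefix v t.val : ℕ) : ZMod p) = ((wtPrefix u t.val : ℕ) : ZMod p) := ⟨u, rfl⟩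
  unfold fTab
  rw [dif_pos h]
  exact hy t _ u ((ZMod.natCast_eq_natCast_iff' _ _ _).mp (Classical.choose_spec h))

/-- the firing table indexed by `t : ℕ` (`false` beyond the last cut). -/
noncomputable def tabN (t : ℕ) (b : ZMod p) : Bool := if h : t < n + 1 then fTab p y ⟨t, h⟩ b else false

/-- the label of cut `t`: `t + W_{<t} (mod 3)`. -/
def labN (u : Fin n → Bool) (t : ℕ) : ZMod 3 := ((t + wtPrefix u t : ℕ) : ZMod 3)

/-- the counter at cut `t`: `W_{<t} (mod p)`. -/
def ctrN (u : Fin n → Bool) (t : ℕ) : ZMod p := ((wtPrefix u t : ℕ) : ZMod p)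

/-- does cut `t` fire on `u`? (read through the counter only) -/
noncomputable def firedN (u : Fin n → Bool) (t : ℕ) : Bool := tabN p y t (ctrN p u t)

/-- the register `∈ V₄` before cut `t`: a fire at cut `j` toggles it at label `labN u j`. -/
noncomputable def regN (u : Fin n → Bool) : ℕ → Bool × Bool
  | 0 => (false, false)
  | t + 1 => if firedN p y u t then tog (labN u t) (regN u t) else regN u t

/-- the state BEFORE the fire decision at cut `t`. -/
noncomputable def X (u : Fin n → Bool) (t : ℕ) : St p := (regN p y u t, labN u t, ctrN p u t)

/-- the state AFTER the fire decision at cut `t`. -/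
noncomputable def Xp (u : Fin n → Bool) (t : ℕ) : St p := (regN p y u (t + 1), labN u t, ctrN p u t)

/-- the fire map of cut `t` on states: toggle the register at the label on the firing fibres. -/
noncomputable def fireMap (t : ℕ) (x : St p) : St p :=
  (if tabN p y t x.2.2 then tog x.2.1 x.1 else x.1, x.2.1, x.2.2)

/-- the fire map is an involution. -/
theorem fireMap_fireMap (t : ℕ) (x : St p) : fireMap p y t (fireMap p y t x) = x := by
  rcases x with ⟨g, a, b⟩
  unfold fireMap
  cases tabN p y t b <;> simp [tog_tog]

/-- after the fire = fire map applied to before the fire. -/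
theorem Xp_eq (u : Fin n → Bool) (t : ℕ) : Xp p y u t = fireMap p y t (X p y u t) := rfl

/-- the initial state. -/
theorem X_zero (u : Fin n → Bool) : X p y u 0 = ((false, false), 0, 0) := by
  simp [X, regN, labN, ctrN, TransferWalk.wtPrefix_zero]

/-- the bit step: `X u (t+1) = bitEq (u t) (Xp u t)`. -/
theorem X_succ (u : Fin n → Bool) (t : Fin n) : X p y u (t.val + 1) = bitEq p (u t) (Xp p y u t.val) := by
  simp only [X, Xp, bitEq_apply, labN, ctrN, wtPrefix_succ_eq, Prod.mk.injEq, true_and]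
  constructor
  · push_cast; ring
  · push_cast; ring

/-- the register's meaning: `ev (regN u t) s` is the parity of the fired cuts `j < t` with label `≠ s`. -/
theorem ev_regN (u : Fin n → Bool) (s : ZMod 3) : ∀ t : ℕ,
    ev (regN p y u t) s
      = decide ((∑ j ∈ range t, if firedN p y u j = true ∧ labN u j ≠ s then 1 else 0) % 2 = 1)
  | 0 => by simp [regN, ev]
  | t + 1 => by
    rw [sum_range_succ]
    simp only [regN]
    have ih := ev_regN u s t
    set N := ∑ j ∈ range t, if firedN p y u j = true ∧ labN u j ≠ s then 1 else 0
    cases hf : firedN p y u t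
    · simp only [Bool.false_eq_true, false_and, if_false, add_zero]
      exact ih
    · rw [if_pos rfl, ev_tog, ih]
      by_cases hs : labN u t = s
      · simp [hs]
      · have hs' : s ≠ labN u t := fun h => hs h.symm
        simp only [true_and, ne_eq, hs, not_false_eq_true, if_true, hs', decide_true, Bool.xor_true]
        rcases Nat.mod_two_eq_zero_or_one N with h | h
        · simp [h, Nat.add_mod]
        · simp [h, Nat.add_mod]

/-- **LOSE in the model**: `u` loses the walk game iff, after cut `n`, `(register, label)` lies in the member
`L_{(n − c, 0)}` of the translate family (`mem`), i.e. `ev reg ((n − c) − label) = false`. -/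
theorem lose_iff
    (hy : ∀ g : Fin (n + 1), ∀ u v : Fin n → Bool, wtPrefix u g.val % p = wtPrefix v g.val % p → y g u = y g v)
    (c : ℕ) (u : Fin n → Bool) :
    ringWinU c y u = false ↔ mem (((n : ℕ) : ZMod 3) - c, none) (Xp p y u n).1 (Xp p y u n).2.1 = true := by
  have hev := ev_regN p y u ((((n : ℕ) : ZMod 3) - c) - labN u n) (n + 1)
  -- the fired/label predicate in the model agrees with the game's predicate, cut by cut
  have hpred : ∀ g : Fin (n + 1), (y g u = true ∧ (c + g.val + walkExp u g.val) % 3 ≠ 0) ↔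
      (firedN p y u g.val = true ∧ labN u g.val ≠ (((n : ℕ) : ZMod 3) - c) - labN u n) := by
    intro g
    have hfire : firedN p y u g.val = y g u := by
      unfold firedN tabN ctrN
      rw [dif_pos g.isLt]
      exact fTab_spec p y hy g u
    rw [hfire]
    apply and_congr_right
    intro _
    unfold labN walkExp
    rw [ConstBells.wtPrefix_self, not_iff_not]
    rw [show (c + g.val + (wt u + wtPrefix u g.val)) % 3 = 0 ↔ (((c + g.val + (wt u + wtPrefix u g.val) : ℕ) : ZMod 3)) = 0
      from by rw [ZMod.natCast_eq_zero_iff, Nat.dvd_iff_mod_eq_zero]]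
    push_cast
    constructor
    · intro h; linear_combination h
    · intro h; linear_combination h
  have hcount : (univ.filter fun g : Fin (n + 1) => y g u = true ∧ (c + g.val + walkExp u g.val) % 3 ≠ 0).card
      = ∑ j ∈ range (n + 1), if firedN p y u j = true ∧ labN u j ≠ (((n : ℕ) : ZMod 3) - c) - labN u n then 1 else 0 := by
    rw [Finset.card_filter, ← Fin.sum_univ_eq_sum_range]
    exact sum_congr rfl fun g _ => by rw [if_congr (hpred g) rfl rfl]
  unfold ringWinU
  rw [hcount]
  simp only [mem, patVal, Xp]
  rw [show (ev (regN p y u (n + 1)) (((n : ℕ) : ZMod 3) - c - labN u n) == false) = !(ev (regN p y u (n + 1))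
      (((n : ℕ) : ZMod 3) - c - labN u n)) from by cases ev (regN p y u (n + 1)) _ <;> rfl, hev]
  simp

/-- prefix-adaptedness of the register: bits `≥ t − 1` are not read before cut `t`'s decision. -/
theorem regN_update (u : Fin n → Bool) (i : Fin n) (β : Bool) : ∀ {t : ℕ}, t ≤ i.val + 1 →
    regN p y (Function.update u i β) t = regN p y u t
  | 0, _ => rfl
  | t + 1, ht => by
    have ht' : t ≤ i.val := by omega
    simp only [regN, firedN, ctrN, labN, wtPrefix_update_of_le u i β ht', regN_update u i β (by omega : t ≤ i.val + 1)]

/-- **adaptedness**: the state after cut `t`'s decision does not read bits `≥ t`. -/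
theorem Xp_update (u : Fin n → Bool) (i : Fin n) (β : Bool) {t : ℕ} (ht : t ≤ i.val) :
    Xp p y (Function.update u i β) t = Xp p y u t := by
  simp only [Xp, labN, ctrN, wtPrefix_update_of_le u i β ht, regN_update p y u i β (by omega : t + 1 ≤ i.val + 1)]

/-! ## §3 Laws of the process -/

/-- the counting law of the state before cut `t`: `law t x = #{u : X u t = x}`. -/
noncomputable def law (t : ℕ) (x : St p) : ℝ := ((univ.filter fun u : Fin n → Bool => X p y u t = x).card : ℝ)

/-- the counting law of the state after cut `t`. -/
noncomputable def lawP (t : ℕ) (x : St p) : ℝ := ((univ.filter fun u : Fin n → Bool => Xp p y u t = x).card : ℝ)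

/-- laws are nonnegative. -/
theorem law_nonneg (t : ℕ) (x : St p) : 0 ≤ law p y t x := Nat.cast_nonneg _

/-- laws are nonnegative. -/
theorem lawP_nonneg (t : ℕ) (x : St p) : 0 ≤ lawP p y t x := Nat.cast_nonneg _

/-- **fire step**: `lawP t = law t ∘ fireMap t`. -/
theorem lawP_eq (t : ℕ) (x : St p) : lawP p y t x = law p y t (fireMap p y t x) := by
  unfold lawP law
  congr 2
  ext u
  simp only [mem_filter, mem_univ, true_and, Xp_eq]
  constructor
  · intro h; rw [← h, fireMap_fireMap]
  · intro h; rw [h, fireMap_fireMap]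

/-- half of the cube has `u i = β`, uniformly on events not reading bit `i`. -/
theorem card_filter_bit_eq_half (i : Fin n) (β : Bool) (P : (Fin n → Bool) → Prop) [DecidablePred P]
    (hP : ∀ u b, P (Function.update u i b) ↔ P u) :
    ((univ.filter fun u : Fin n → Bool => u i = β ∧ P u).card : ℝ) = (univ.filter P).card / 2 := by
  have hflip : ∀ β' : Bool, (univ.filter fun u : Fin n → Bool => u i = β' ∧ P u).card
      = (univ.filter fun u : Fin n → Bool => u i = !β' ∧ P u).card := by
    intro β'
    refine card_nbij' (fun u => Function.update u i (!β')) (fun u => Function.update u i β') ?_ ?_ ?_ ?_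
    · intro u hu
      simp only [coe_filter, mem_univ, true_and, Set.mem_setOf_eq] at hu ⊢
      exact ⟨by simp, (hP u _).mpr hu.2⟩
    · intro u hu
      simp only [coe_filter, mem_univ, true_and, Set.mem_setOf_eq] at hu ⊢
      exact ⟨by simp, (hP u _).mpr hu.2⟩
    · intro u hu
      simp only [coe_filter, mem_univ, true_and, Set.mem_setOf_eq] at hu
      dsimp only
      rw [Function.update_idem, ← hu.1, Function.update_eq_self]
    · intro u hu
      simp only [coe_filter, mem_univ, true_and, Set.mem_setOf_eq] at hu
      dsimp only
      rw [Function.update_idem, ← hu.1, Function.update_eq_self]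
  have hsplit : (univ.filter P).card = (univ.filter fun u : Fin n → Bool => u i = β ∧ P u).card
      + (univ.filter fun u : Fin n → Bool => u i = !β ∧ P u).card := by
    rw [← card_union_of_disjoint]
    · congr 1; ext u
      simp only [mem_filter, mem_univ, true_and, mem_union]
      constructor
      · intro h; cases hu : u i <;> cases β <;> simp [h]
      · rintro (h | h) <;> exact h.2
    · rw [disjoint_filter]
      rintro u _ ⟨h1, _⟩ ⟨h2, _⟩
      rw [h1] at h2; cases β <;> simp at h2
  rw [hsplit, ← hflip β, Nat.cast_add]
  ring

/-- **bit step**: `law (t+1) (g, a, b) = ½ (lawP t (g, a−1, b) + lawP t (g, a−2, b−1))`. -/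
theorem law_succ (t : Fin n) (x : St p) :
    law p y (t.val + 1) x = (lawP p y t.val (x.1, x.2.1 - 1, x.2.2) + lawP p y t.val (x.1, x.2.1 - 2, x.2.2 - 1)) / 2 := by
  have hsplit : (univ.filter fun u : Fin n → Bool => X p y u (t.val + 1) = x)
      = (univ.filter fun u : Fin n → Bool => u t = false ∧ Xp p y u t.val = (bitEq p false).symm x) ∪
        (univ.filter fun u : Fin n → Bool => u t = true ∧ Xp p y u t.val = (bitEq p true).symm x) := by
    ext u
    simp only [mem_filter, mem_univ, true_and, mem_union, X_succ, Equiv.eq_symm_apply]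
    cases u t <;> simp
  have hdisj : Disjoint (univ.filter fun u : Fin n → Bool => u t = false ∧ Xp p y u t.val = (bitEq p false).symm x)
      (univ.filter fun u : Fin n → Bool => u t = true ∧ Xp p y u t.val = (bitEq p true).symm x) := by
    rw [disjoint_filter]
    rintro u _ ⟨h1, _⟩ ⟨h2, _⟩
    rw [h1] at h2; exact Bool.false_ne_true h2
  unfold law
  rw [hsplit, card_union_of_disjoint hdisj, Nat.cast_add,
    card_filter_bit_eq_half t false _ (fun u b => by rw [Xp_update p y u t b le_rfl]),
    card_filter_bit_eq_half t true _ (fun u b => by rw [Xp_update p y u t b le_rfl])]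
  unfold lawP
  have h0 : (bitEq p false).symm x = (x.1, x.2.1 - 1, x.2.2) := by
    rw [bitEq_symm_apply]; simp
  have h1 : (bitEq p true).symm x = (x.1, x.2.1 - 2, x.2.2 - 1) := by
    rw [bitEq_symm_apply]; norm_num
  rw [h0, h1]
  ring

/-- the initial law is the point mass `2ⁿ·δ_{(0,0,0)}`. -/
theorem law_zero (x : St p) : law p y 0 x = if x = ((false, false), 0, 0) then 2 ^ n else 0 := by
  unfold law
  simp only [X_zero]
  by_cases hx : x = ((false, false), 0, 0)
  · rw [if_pos hx]; subst hx; simp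
  · rw [if_neg hx]
    simp [Ne.symm hx]

variable [NeZero p]

/-- total mass `2ⁿ`. -/
theorem sum_law (t : ℕ) : ∑ x, law p y t x = 2 ^ n := by
  unfold law
  rw [← Nat.cast_sum, ← card_eq_sum_card_fiberwise (s := univ) (t := univ) (fun u _ => mem_univ (X p y u t))]
  simp

/-- total mass `2ⁿ`. -/
theorem sum_lawP (t : ℕ) : ∑ x, lawP p y t x = 2 ^ n := by
  unfold lawP
  rw [← Nat.cast_sum, ← card_eq_sum_card_fiberwise (s := univ) (t := univ) (fun u _ => mem_univ (Xp p y u t))]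
  simp

/-- **the LOSE count as a mass of the final law**: `#{u : LOSE} = Σ_b mass (lawP n) (n − c, 0) b`. -/
theorem card_lose_eq
    (hy : ∀ g : Fin (n + 1), ∀ u v : Fin n → Bool, wtPrefix u g.val % p = wtPrefix v g.val % p → y g u = y g v)
    (c : ℕ) :
    ((univ.filter fun u : Fin n → Bool => ringWinU c y u = false).card : ℝ)
      = ∑ b : ZMod p, mass (lawP p y n) (((n : ℕ) : ZMod 3) - c, none) b := by
  set i₀ : Idx := (((n : ℕ) : ZMod 3) - c, none)
  have h1 : (univ.filter fun u : Fin n → Bool => ringWinU c y u = false)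
      = univ.filter fun u : Fin n → Bool => mem i₀ (Xp p y u n).1 (Xp p y u n).2.1 = true := by
    ext u; simp only [mem_filter, mem_univ, true_and, lose_iff p y hy c u, i₀]
  rw [h1, card_eq_sum_card_fiberwise (t := univ) (f := fun u => Xp p y u n) (fun u _ => mem_univ _), Nat.cast_sum,
    sum_St]
  refine sum_congr rfl fun b _ => ?_
  unfold mass lawP
  refine sum_congr rfl fun g _ => sum_congr rfl fun a _ => ?_
  by_cases hm : mem i₀ g a = true
  · rw [if_pos hm]
    congr 2; ext u
    simp only [mem_filter, mem_univ, true_and]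
    constructor
    · exact fun h => h.2
    · intro h; refine ⟨?_, h⟩; rw [h]; exact hm
  · rw [if_neg hm]
    norm_cast
    rw [card_eq_zero, filter_eq_empty_iff]
    rintro u hu h
    simp only [mem_filter, mem_univ, true_and] at hu
    rw [h] at hu; exact hm hu

end Process

end Summit.QuantumAdvantage.AdviceFreeQNC0.CounterLaw
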